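import Literature.Geometry.Riemannian.CutLocusBishopDensity
import Literature.Geometry.Riemannian.ExponentialMapProofs
import Literature.Geometry.Lorentzian.GeodesicConfinement
import Literature.Geometry.Lorentzian.LeviCivitaProofs
import HarnessLib

/-!
# Bishop 1977, density of the ordinary cut points: the exponential-map side of the hypotheses

Third sibling proof file of `Literature/Geometry/Riemannian/CutLocusBishop.lean` (named fact
`bishop1977_ordinary_dense`). `CutLocusBishopDensity.lean` proves Bishop's density theorem
(`cutLocus_subset_closure_of_nonbranching`) from: non-branching of unit-speed segments, and an
abstract continuous map `ex : E → M` with `ex 0 = p`, injective on rays, such that every point is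
the endpoint of a minimal segment `s ↦ ex (s • v)` with `‖v‖ ≤ C d(p, x)`. This file discharges,
for `ex = exp_p = riemannianExpMap g p` of `ExponentialMap.lean` on a geodesically complete
manifold, the parts of these hypotheses that need only the geodesic ODE and the length structure
(the layer of `ExponentialMapProofs.lean`: rescaling `exp_p (t v) = γ_v(t)`, constant speed,
`d ≤ L` along geodesics):

* `eq_of_forall_expMap_smul_eq` — **injectivity on rays** (any complete `C¹` connection): if
  `exp_x (t v) = exp_x (t w)` for all `t ∈ [0, 1]` then `v = w` — the geodesics `γ_v`, `γ_w` agree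
  on `[0, 1]`, hence have the same 1-jet at `t = 1/2`, hence coincide (uniqueness of geodesics,
  `IsGeodesicOn.eqOn_of_velocity_eq_holds`), so `v = γ_v'(0) = γ_w'(0) = w`;
* `edist_eq_of_isMinimizingUpTo`, `edist_expMap_smul_of_isMinimizingUpTo` — if `γ_v|[0,1]` is
  minimizing (`IsMinimizingUpTo g hg p v 1`, Lee 2018 p. 308) then `d(p, exp_p v) = |v|_g` and the
  ray `s ↦ exp_p (s v)` is a **metric minimal segment**:
  `d(exp_p (s v), exp_p (t v)) = |s - t| d(p, exp_p v)` on `[0, 1]` (`d ≤ L = |s - t| |v|` along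
  the geodesic, and the triangle inequality through the endpoints);
* `exists_norm_le_mul_sqrt` — the model norm of `T_pM = E` is bounded by a multiple of
  `|v|_g = g_p(v, v)^{1/2}` (positive definiteness on a finite-dimensional space);
* `isGeodesicallyComplete_of_isCompact_closedBall` — **metrically complete (closed distance balls
  compact) ⇒ geodesically complete** (the escape-lemma half of Hopf–Rinow, Lee Thm. 6.19 /
  Cor. 6.20), by the tree's completeness criterion `isGeodesicallyComplete_of_uniformTime` and the
  compactness of the set of short vectors over a compact ball (`exists_isCompact_tangent_superset`);
* `cutLocus_subset_closure_of_hopfRinow` — hence **Bishop's density for `(M, g, p)`** from: closed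
  balls compact, non-branching of segments, continuity of `exp_p`, and the Hopf–Rinow conclusion
  `∀ q, ∃ v, γ_v|[0,1] minimizing ∧ exp_p v = q` (Lee Cor. 6.21; the shape of the tree's
  `hopfRinow_compact` and of the hypothesis `hHR` of `ExponentialMapProofs.lean`);
* `bishop1977_ordinary_dense_of_hopfRinow` — the named fact from these three classical statements
  on every connected complete boundaryless Riemannian manifold (the Levi-Civita connection of a
  smooth metric exists and is `C¹`: `hasLeviCivita`, `isLocallyContMDiff_leviCivita_holds`).

No definitions and no named facts are introduced (D-0026). Still missing for
`bishop1977_ordinary_dense_holds`: the existence half of Hopf–Rinow for complete metrics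
(minimizing GEODESICS to every point: metric segments exist, `exists_unitSpeed_segment`, but that
they are geodesics is the local theory), continuity of `exp_p`, and non-branching of segments
(minimising curves are geodesics, Lee Thm. 6.4).

## References

* R. L. Bishop, *Decomposition of cut loci*, Proc. AMS 65 (1977) 133–136 [Bishop1977].
* J. M. Lee, *Introduction to Riemannian Manifolds*, 2nd ed. (2018), Lemma 5.18, Prop. 5.19,
  Cor. 5.6, Thm. 6.4, Cor. 6.20–6.21, p. 308, Prop. 10.32 [LeeRiemannianManifolds2018].
-/

noncomputable section

open Bundle Set Filter Manifold
open scoped Manifold ContDiff Topology ENNReal NNReal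

namespace Literature.Geometry.Riemannian

open Literature.Geometry.Lorentzian
open Literature.Geometry.Lorentzian.PseudoRiemannianMetric

/-! ### Injectivity of the exponential map on rays -/

section Connection

variable {E : Type*} [NormedAddCommGroup E] [NormedSpace ℝ E] {H : Type*} [TopologicalSpace H]
  {I : ModelWithCorners ℝ E H} {M : Type*} [TopologicalSpace M] [ChartedSpace H M]
  [IsManifold I ∞ M] [FiniteDimensional ℝ E]
  {cov : CovariantDerivative I E (TangentSpace I : M → Type _)}
  [CompleteSpace E] [T2Space M] [BoundarylessManifold I M]
  [CovariantDerivative.ContMDiffCovariantDerivative cov 1]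

/-- **The exponential map of a complete `C¹` connection is injective on rays**: if
`exp_x (t v) = exp_x (t w)` for all `t ∈ [0, 1]`, then `v = w`. By the rescaling lemma
(`expMap_smul`, Lee 2018, Lemma 5.18 / Prop. 5.19 (b)) the geodesics `γ_v` and `γ_w` agree on
`[0, 1]`, so they have the same position and velocity at `t = 1/2` (locality of `mfderiv`); by
uniqueness of geodesics (`IsGeodesicOn.eqOn_of_velocity_eq_holds`, O'Neill 1983, Ch. 3, Lemma 22)
they agree on `ℝ`, and `v = γ_v'(0) = γ_w'(0) = w`. [cite: LeeRiemannianManifolds2018, Prop. 5.19 (b)] -/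
theorem eq_of_forall_expMap_smul_eq (hc : IsGeodesicallyComplete cov) (x : M)
    {v w : TangentSpace I x}
    (h : ∀ t ∈ Icc (0 : ℝ) 1, expMap cov x (t • v) = expMap cov x (t • w)) : v = w := by
  obtain ⟨-, hgv, -, hvv⟩ := maximalGeodesic_of_isGeodesicallyComplete hc x v
  obtain ⟨-, hgw, -, hwv⟩ := maximalGeodesic_of_isGeodesicallyComplete hc x w
  -- the two geodesics agree on `[0, 1]`
  have hagree : EqOn (maximalGeodesic cov x v) (maximalGeodesic cov x w) (Icc 0 1) := by
    intro t ht
    rw [← expMap_smul hc x v t, ← expMap_smul hc x w t]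
    exact h t ht
  -- hence near `1/2`: same position and velocity there
  have hI : Icc (0 : ℝ) 1 ∈ 𝓝 (1 / 2 : ℝ) := Icc_mem_nhds (by norm_num) (by norm_num)
  have hev : maximalGeodesic cov x v =ᶠ[𝓝 (1 / 2 : ℝ)] maximalGeodesic cov x w :=
    Filter.eventuallyEq_of_mem hI hagree
  have hpos : maximalGeodesic cov x v (1 / 2) = maximalGeodesic cov x w (1 / 2) :=
    hagree ⟨by norm_num, by norm_num⟩
  have hvel : (velocity I (maximalGeodesic cov x v) (1 / 2) : E) =
      velocity I (maximalGeodesic cov x w) (1 / 2) := by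
    show mfderiv 𝓘(ℝ, ℝ) I (maximalGeodesic cov x v) (1 / 2) 1 =
      mfderiv 𝓘(ℝ, ℝ) I (maximalGeodesic cov x w) (1 / 2) 1
    rw [hev.mfderiv_eq]
    rfl
  -- uniqueness of geodesics: agreement on `ℝ`
  have hall : EqOn (maximalGeodesic cov x v) (maximalGeodesic cov x w) univ :=
    IsGeodesicOn.eqOn_of_velocity_eq_holds isOpen_univ Set.ordConnected_univ
      (hgv.isGeodesicOn univ) (hgw.isGeodesicOn univ) (mem_univ (1 / 2 : ℝ)) hpos hvel
  have hfun : maximalGeodesic cov x v = maximalGeodesic cov x w :=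
    funext fun t => hall (mem_univ t)
  -- initial velocities
  have key : (velocity I (maximalGeodesic cov x v) 0 : E) = velocity I (maximalGeodesic cov x w) 0 :=
    congrArg (fun γ : ℝ → M => (velocity I γ 0 : E)) hfun
  exact hvv.symm.trans (key.trans hwv)

end Connection

/-! ### Minimizing geodesic segments are metric segments -/

section Riemannian

variable {E : Type*} [NormedAddCommGroup E] [NormedSpace ℝ E] {H : Type*} [TopologicalSpace H]
  {I : ModelWithCorners ℝ E H} {M : Type*} [TopologicalSpace M] [ChartedSpace H M]
  [IsManifold I ∞ M] {n : ℕ∞ω} [FiniteDimensional ℝ E]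
  {g : PseudoRiemannianMetric I n E (TangentSpace I : M → Type _)}

/-- **The model norm against `|v|_g`**: for a Riemannian `g` and a point `p` there is `C ≥ 0` with
`‖v‖ ≤ C g_p(v, v)^{1/2}` for all `v ∈ T_pM = E` (a positive definite form on a
finite-dimensional normed space dominates a multiple of the square norm,
`exists_pos_mul_norm_sq_le_of_pos_def`). [folklore] -/
theorem exists_norm_le_mul_sqrt (hg : g.IsRiemannian) (p : M) :
    ∃ C : ℝ, 0 ≤ C ∧ ∀ v : E, ‖v‖ ≤ C * Real.sqrt (g.val p v v) := by
  obtain ⟨c, hc, hcv⟩ := exists_pos_mul_norm_sq_le_of_pos_def (E := E)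
    (g.val p : E →L[ℝ] E →L[ℝ] ℝ) (fun v hv => hg p v hv)
  have hc' : 0 < Real.sqrt c := Real.sqrt_pos.2 hc
  refine ⟨(Real.sqrt c)⁻¹, by positivity, fun v => ?_⟩
  have hsq : (‖v‖ * Real.sqrt c) ^ 2 ≤ g.val p v v := by
    calc (‖v‖ * Real.sqrt c) ^ 2 = c * ‖v‖ ^ 2 := by rw [mul_pow, Real.sq_sqrt hc.le]; ring
      _ ≤ g.val p v v := hcv v
  have h1 : ‖v‖ * Real.sqrt c ≤ Real.sqrt (g.val p v v) :=
    (Real.le_sqrt (by positivity) ((sq_nonneg _).trans hsq)).2 hsq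
  calc ‖v‖ = ‖v‖ * Real.sqrt c * (Real.sqrt c)⁻¹ := (mul_inv_cancel_right₀ hc'.ne' _).symm
    _ ≤ Real.sqrt (g.val p v v) * (Real.sqrt c)⁻¹ :=
        mul_le_mul_of_nonneg_right h1 (inv_nonneg.2 hc'.le)
    _ = (Real.sqrt c)⁻¹ * Real.sqrt (g.val p v v) := mul_comm _ _

variable [CompleteSpace E] [Fact (1 ≤ n)] [g.HasLeviCivita] [T2Space M] [BoundarylessManifold I M]
  [CovariantDerivative.ContMDiffCovariantDerivative g.leviCivita 1]

/-- **The length of a minimizing geodesic segment is the distance of its endpoints, `= |v|_g`**: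
if `γ_v|[0,1]` is minimizing then `d(p, exp_p v) = g_p(v,v)^{1/2}` (`L(γ_v|[0,1]) = |v|`,
`length_maximalGeodesic`, and `exp_p v = γ_v(1)`). [cite: LeeRiemannianManifolds2018, p. 308] -/
theorem edist_eq_of_isMinimizingUpTo (hg : g.IsRiemannian)
    (hc : IsGeodesicallyComplete g.leviCivita) {p : M} {v : TangentSpace I p}
    (hmin : IsMinimizingUpTo g hg p v 1) :
    g.edist hg p (riemannianExpMap g p v) = ENNReal.ofReal (Real.sqrt (g.val p v v)) := by
  have h1 : riemannianExpMap g p v = maximalGeodesic g.leviCivita p v 1 :=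
    expMap_eq_maximalGeodesic hc p v
  rw [h1, ← hmin.2, length_maximalGeodesic hg hc p v 0 1, sub_zero, one_mul]

/-- **A minimizing geodesic segment is a metric minimal segment**: if `γ_v|[0,1]` is minimizing,
then for `s, t ∈ [0, 1]`, `d(exp_p (s v), exp_p (t v)) = |s - t| · d(p, exp_p v)`. Proof: with
`ℓ = |v|_g = d(p, exp_p v)` and `s ≤ t`, `d(γ_v s, γ_v t) ≤ L(γ_v|[s,t]) = (t - s) ℓ`
(`edist_maximalGeodesic_le_length`), and the triangle inequality
`ℓ = d(p, q) ≤ d(p, γ_v s) + d(γ_v s, γ_v t) + d(γ_v t, q) ≤ s ℓ + d(γ_v s, γ_v t) + (1 - t) ℓ`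
gives `≥` (Lee 2018, proof of Prop. 10.32 (a): sub-segments of minimizing segments minimize).
[cite: LeeRiemannianManifolds2018, Prop. 10.32 (a) (proof)] -/
theorem edist_expMap_smul_of_isMinimizingUpTo (hg : g.IsRiemannian)
    (hc : IsGeodesicallyComplete g.leviCivita) {p : M} {v : TangentSpace I p}
    (hmin : IsMinimizingUpTo g hg p v 1) :
    ∀ s ∈ Icc (0 : ℝ) 1, ∀ t ∈ Icc (0 : ℝ) 1,
      g.edist hg (riemannianExpMap g p (s • v)) (riemannianExpMap g p (t • v)) =
        ENNReal.ofReal |s - t| * g.edist hg p (riemannianExpMap g p v) := by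
  obtain ⟨-, -, h0, -⟩ := maximalGeodesic_of_isGeodesicallyComplete hc p v
  have hdpq := edist_eq_of_isMinimizingUpTo hg hc hmin
  have hexp : ∀ t : ℝ, riemannianExpMap g p (t • v) = maximalGeodesic g.leviCivita p v t :=
    fun t => expMap_smul hc p v t
  have h1 : riemannianExpMap g p v = maximalGeodesic g.leviCivita p v 1 :=
    expMap_eq_maximalGeodesic hc p v
  set γ := maximalGeodesic g.leviCivita p v with hγ
  set ℓ : ℝ := Real.sqrt (g.val p v v) with hℓ
  have hℓ0 : 0 ≤ ℓ := Real.sqrt_nonneg _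
  rw [h1] at hdpq
  -- upper bounds along the geodesic
  have hup : ∀ a b : ℝ, a ≤ b → g.edist hg (γ a) (γ b) ≤ ENNReal.ofReal ((b - a) * ℓ) := by
    intro a b hab
    rw [← length_maximalGeodesic hg hc p v a b]
    exact edist_maximalGeodesic_le_length hg hc p v hab
  -- the ordered case
  have key : ∀ s t : ℝ, 0 ≤ s → s ≤ t → t ≤ 1 →
      g.edist hg (γ s) (γ t) = ENNReal.ofReal ((t - s) * ℓ) := by
    intro s t hs hst ht1
    refine le_antisymm (hup s t hst) ?_
    have hA : g.edist hg p (γ s) ≤ ENNReal.ofReal (s * ℓ) := by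
      have h := hup 0 s hs
      rwa [h0, sub_zero] at h
    have hC : g.edist hg (γ t) (γ 1) ≤ ENNReal.ofReal ((1 - t) * ℓ) := hup t 1 ht1
    have htri : ENNReal.ofReal ℓ ≤
        ENNReal.ofReal (s * ℓ) + g.edist hg (γ s) (γ t) + ENNReal.ofReal ((1 - t) * ℓ) := by
      rw [← hdpq]
      calc g.edist hg p (γ 1) ≤ g.edist hg p (γ t) + g.edist hg (γ t) (γ 1) :=
            edist_triangle hg _ _ _
        _ ≤ (g.edist hg p (γ s) + g.edist hg (γ s) (γ t)) + g.edist hg (γ t) (γ 1) := by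
            gcongr
            exact edist_triangle hg _ _ _
        _ ≤ ENNReal.ofReal (s * ℓ) + g.edist hg (γ s) (γ t) + ENNReal.ofReal ((1 - t) * ℓ) :=
            add_le_add (add_le_add hA le_rfl) hC
    have hsplit : ENNReal.ofReal ℓ = ENNReal.ofReal (s * ℓ) + ENNReal.ofReal ((t - s) * ℓ) +
        ENNReal.ofReal ((1 - t) * ℓ) := by
      rw [← ENNReal.ofReal_add (mul_nonneg hs hℓ0) (mul_nonneg (sub_nonneg.2 hst) hℓ0),
        ← ENNReal.ofReal_add (add_nonneg (mul_nonneg hs hℓ0) (mul_nonneg (sub_nonneg.2 hst) hℓ0))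
          (mul_nonneg (sub_nonneg.2 ht1) hℓ0)]
      congr 1
      ring
    rw [hsplit] at htri
    exact (ENNReal.add_le_add_iff_left ENNReal.ofReal_ne_top).1
      ((ENNReal.add_le_add_iff_right ENNReal.ofReal_ne_top).1 htri)
  intro s hs t ht
  rw [hexp s, hexp t, h1, hdpq]
  rcases le_total s t with hst | hts
  · rw [key s t hs.1 hst ht.2, abs_sub_comm, abs_of_nonneg (sub_nonneg.2 hst),
      ENNReal.ofReal_mul (sub_nonneg.2 hst)]
  · rw [PseudoRiemannianMetric.edist_comm hg, key t s ht.1 hts hs.2,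
      abs_of_nonneg (sub_nonneg.2 hts), ENNReal.ofReal_mul (sub_nonneg.2 hts)]

/-- **A Riemannian manifold whose closed distance balls are compact is geodesically complete**
(the half "metrically complete ⇒ geodesically complete" of the Hopf–Rinow theorem, Lee 2018,
Thm. 6.19 with Lemma 6.19 (escape lemma) and Cor. 6.20; O'Neill 1983, Ch. 5, Lemma 8 and
Thm. 21). Proof by the tree's completeness criterion `isGeodesicallyComplete_of_uniformTime`:
a geodesic `γ` with `γ 0 = x`, `γ' 0 = v` has constant speed `|v|`
(`val_velocity_eq_of_isGeodesicOn_holds`) and `d(x, γ t) ≤ L(γ|[0,t]) = |t| |v|`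
(`edist_le_length`, `length_eq_of_isGeodesicOn`), so for `|t| < T` its tangent lift lies in the
compact set of vectors of `g`-square-length `≤ g(v,v)` over the compact ball
`{d(x, ·) ≤ T |v|}` (`exists_isCompact_tangent_superset`), on which geodesics have a uniform
existence time (`exists_uniform_isGeodesicOn_of_isCompact`).
[cite: LeeRiemannianManifolds2018, Thm. 6.19 and Cor. 6.20] -/
theorem isGeodesicallyComplete_of_isCompact_closedBall (hg : g.IsRiemannian)
    (hc : ∀ (x : M) (r : ℝ≥0), IsCompact {y | g.edist hg x y ≤ r}) :
    IsGeodesicallyComplete g.leviCivita := by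
  haveI : LocallyCompactSpace M := Manifold.locallyCompact_of_finiteDimensional (M := M) I
  refine isGeodesicallyComplete_of_uniformTime fun x v T hT => ?_
  set c : ℝ := Real.sqrt (g.val x v v) with hc_def
  have hc0 : 0 ≤ c := Real.sqrt_nonneg _
  -- the compact ball of radius `T |v|` about `x` and the compact set of short vectors over it
  set R : ℝ := T * c with hR
  have hR0 : 0 ≤ R := mul_nonneg hT.le hc0
  have hK : IsCompact {y | g.edist hg x y ≤ (R.toNNReal : ℝ≥0∞)} := hc x R.toNNReal
  obtain ⟨𝒦, h𝒦, h𝒦mem⟩ :=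
    g.exists_isCompact_tangent_superset (fun y u hu => hg y u hu) hK (g.val x v v)
  obtain ⟨ε, hε, huni⟩ := exists_uniform_isGeodesicOn_of_isCompact (cov := g.leviCivita) h𝒦
  refine ⟨𝒦, ε, hε, huni, fun γ a b ha hb hγ h0 hv0 t ht htT => ?_⟩
  subst h0
  -- constant speed
  have hspeed : ∀ τ ∈ Ioo a b,
      g.val (γ τ) (velocity I γ τ) (velocity I γ τ) = g.val (γ 0) v v := by
    intro τ hτ
    rw [← hv0]
    exact g.val_velocity_eq_of_isGeodesicOn_holds isOpen_Ioo Set.ordConnected_Ioo hγ hτ ⟨ha, hb⟩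
  refine h𝒦mem _ ?_ (hspeed t ht).le
  -- `d(γ 0, γ t) ≤ |t| |v| ≤ T |v| = R`
  show g.edist hg (γ 0) (γ t) ≤ (R.toNNReal : ℝ≥0∞)
  rw [show ((R.toNNReal : ℝ≥0) : ℝ≥0∞) = ENNReal.ofReal R from rfl]
  have hC1 : ContMDiffOn 𝓘(ℝ, ℝ) I 1 γ (Ioo a b) := hγ.contMDiffOn_one isOpen_Ioo
  have hlen : ∀ s₁ s₂ : ℝ, Icc s₁ s₂ ⊆ Ioo a b →
      g.length hg γ s₁ s₂ = ENNReal.ofReal ((s₂ - s₁) * c) := by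
    intro s₁ s₂ hsub
    rw [length_eq_of_isGeodesicOn hg isOpen_Ioo Set.ordConnected_Ioo hγ hsub ⟨ha, hb⟩, hv0]
  rcases le_total 0 t with ht0 | ht0
  · have hsub : Icc 0 t ⊆ Ioo a b := fun s hs => ⟨ha.trans_le hs.1, hs.2.trans_lt ht.2⟩
    calc g.edist hg (γ 0) (γ t) ≤ g.length hg γ 0 t := edist_le_length hg ht0 (hC1.mono hsub)
      _ = ENNReal.ofReal ((t - 0) * c) := hlen 0 t hsub
      _ ≤ ENNReal.ofReal R := ENNReal.ofReal_le_ofReal (by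
          rw [sub_zero, hR]
          exact mul_le_mul_of_nonneg_right ((le_abs_self t).trans htT.le) hc0)
  · have hsub : Icc t 0 ⊆ Ioo a b := fun s hs => ⟨ht.1.trans_le hs.1, hs.2.trans_lt hb⟩
    calc g.edist hg (γ 0) (γ t) = g.edist hg (γ t) (γ 0) := PseudoRiemannianMetric.edist_comm hg _ _
      _ ≤ g.length hg γ t 0 := edist_le_length hg ht0 (hC1.mono hsub)
      _ = ENNReal.ofReal ((0 - t) * c) := hlen t 0 hsub
      _ ≤ ENNReal.ofReal R := ENNReal.ofReal_le_ofReal (by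
          rw [zero_sub, hR]
          exact mul_le_mul_of_nonneg_right ((neg_le_abs t).trans htT.le) hc0)

end Riemannian

/-! ### Bishop's density theorem from Hopf–Rinow, continuity of `exp_p` and non-branching -/

section Assembly

variable {E : Type*} [NormedAddCommGroup E] [NormedSpace ℝ E] {H : Type*} [TopologicalSpace H]
  {I : ModelWithCorners ℝ E H} {M : Type*} [TopologicalSpace M] [ChartedSpace H M]
  [IsManifold I ∞ M] {n : ℕ∞ω} [FiniteDimensional ℝ E]
  {g : PseudoRiemannianMetric I n E (TangentSpace I : M → Type _)}
  [CompleteSpace E] [Fact (1 ≤ n)] [g.HasLeviCivita] [T2Space M] [ConnectedSpace M]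
  [I.Boundaryless] [CovariantDerivative.ContMDiffCovariantDerivative g.leviCivita 1]

/-- **Bishop 1977 (density of the ordinary cut points) from Hopf–Rinow, continuity of `exp_p`
and non-branching.** Let `(M, g)` be a connected Riemannian manifold without boundary whose
closed distance balls are compact (so that the Levi-Civita connection is geodesically complete,
`isGeodesicallyComplete_of_isCompact_closedBall`); assume unit-speed segments do not branch (`hNB`: minimising curves are geodesics, Lee 2018 Thm. 6.4, and
uniqueness of geodesics), `exp_p : T_pM → M` is continuous (Lee Prop. 5.19), and every `q` is
`exp_p v` with `γ_v|[0,1]` minimizing (Hopf–Rinow, Lee Cor. 6.21). Then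
`cutLocus g hg p ⊆ closure {q ∈ cutLocus g hg p | 2 ≤ multiplicity}`. By
`cutLocus_subset_closure_of_nonbranching` with `ex = exp_p`: `exp_p 0 = p`
(`riemannianExpMap_zero`), injectivity on rays (`eq_of_forall_expMap_smul_eq`), and minimising
vectors with norm bound (`edist_expMap_smul_of_isMinimizingUpTo`, `edist_eq_of_isMinimizingUpTo`,
`exists_norm_le_mul_sqrt`). [cite: Bishop1977, Main Theorem (p. 133) and §4] -/
theorem cutLocus_subset_closure_of_hopfRinow (hg : g.IsRiemannian)
    (hc : ∀ (x : M) (r : ℝ≥0), IsCompact {y | g.edist hg x y ≤ r})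
    (hNB : ∀ (σ₁ σ₂ : ℝ → M) (ℓ a b : ℝ), 0 ≤ a → a < b → b ≤ ℓ →
      (∀ s ∈ Icc 0 ℓ, ∀ t ∈ Icc 0 ℓ, g.edist hg (σ₁ s) (σ₁ t) = ENNReal.ofReal |s - t|) →
      (∀ s ∈ Icc 0 ℓ, ∀ t ∈ Icc 0 ℓ, g.edist hg (σ₂ s) (σ₂ t) = ENNReal.ofReal |s - t|) →
      EqOn σ₁ σ₂ (Icc a b) → EqOn σ₁ σ₂ (Icc 0 ℓ))
    {p : M}
    (hexc : Continuous fun w : E => riemannianExpMap g p (show TangentSpace I p from w))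
    (hHR : ∀ q : M, ∃ v : TangentSpace I p,
      IsMinimizingUpTo g hg p v 1 ∧ riemannianExpMap g p v = q) :
    cutLocus g hg p ⊆
      closure {q | q ∈ cutLocus g hg p ∧ 2 ≤ minimalGeodesicMultiplicity g hg p q} := by
  have hcpl : IsGeodesicallyComplete g.leviCivita := isGeodesicallyComplete_of_isCompact_closedBall hg hc
  obtain ⟨C, -, hC⟩ := exists_norm_le_mul_sqrt hg p
  refine cutLocus_subset_closure_of_nonbranching hg hc hNB
    (ex := fun w : E => riemannianExpMap g p (show TangentSpace I p from w)) hexc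
    (riemannianExpMap_zero g p) (fun v w h => eq_of_forall_expMap_smul_eq hcpl p h) (C := C)
    fun x => ?_
  obtain ⟨v, hmin, hvx⟩ := hHR x
  refine ⟨v, ?_, hvx, ?_⟩
  · have hd : g.edist hg p x = ENNReal.ofReal (Real.sqrt (g.val p v v)) := by
      rw [← hvx]
      exact edist_eq_of_isMinimizingUpTo hg hcpl hmin
    rw [hd, ENNReal.toReal_ofReal (Real.sqrt_nonneg _)]
    exact hC v
  · rw [← hvx]
    exact edist_expMap_smul_of_isMinimizingUpTo hg hcpl hmin

end Assembly

/-! ### The named fact from Hopf–Rinow, continuity of `exp_p` and non-branching -/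

section Fact

universe u v w

/-- **`bishop1977_ordinary_dense` from three classical statements about complete Riemannian
manifolds.** Suppose that on every connected boundaryless `C^∞` Riemannian manifold whose closed
distance balls are compact: (i) unit-speed minimal segments do not branch (minimising curves are
geodesics, Lee 2018 Thm. 6.4, plus uniqueness of geodesics); (ii) `exp_p` is continuous for every
`p` (Lee Prop. 5.19); (iii) every `q` is `exp_p v` with `γ_v|[0,1]` minimizing (Hopf–Rinow, Lee
Cor. 6.21). Then Bishop's density theorem `bishop1977_ordinary_dense` holds
(`cutLocus_subset_closure_of_hopfRinow`; the Levi-Civita connection of a smooth metric exists,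
`hasLeviCivita`, is `C¹`, `isLocallyContMDiff_leviCivita_holds`, and is geodesically complete,
`isGeodesicallyComplete_of_isCompact_closedBall`). The hypothesis is the part of the classical
theory of geodesics not yet proved in the tree.
[cite: Bishop1977, Main Theorem (p. 133) and §4] -/
theorem bishop1977_ordinary_dense_of_hopfRinow
    (hlocal : ∀ {E : Type u} [NormedAddCommGroup E] [NormedSpace ℝ E] [FiniteDimensional ℝ E]
      [CompleteSpace E]
      {H : Type v} [TopologicalSpace H] (I : ModelWithCorners ℝ E H) [I.Boundaryless]
      {M : Type w} [TopologicalSpace M] [ChartedSpace H M] [IsManifold I ∞ M]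
      [T2Space M] [ConnectedSpace M]
      (g : PseudoRiemannianMetric I ∞ E (TangentSpace I : M → Type _)) [g.HasLeviCivita]
      [CovariantDerivative.ContMDiffCovariantDerivative g.leviCivita 1] (hg : g.IsRiemannian),
      (∀ (x : M) (r : ℝ≥0), IsCompact {y | g.edist hg x y ≤ r}) →
      (∀ (σ₁ σ₂ : ℝ → M) (ℓ a b : ℝ), 0 ≤ a → a < b → b ≤ ℓ →
        (∀ s ∈ Icc 0 ℓ, ∀ t ∈ Icc 0 ℓ, g.edist hg (σ₁ s) (σ₁ t) = ENNReal.ofReal |s - t|) →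
        (∀ s ∈ Icc 0 ℓ, ∀ t ∈ Icc 0 ℓ, g.edist hg (σ₂ s) (σ₂ t) = ENNReal.ofReal |s - t|) →
        EqOn σ₁ σ₂ (Icc a b) → EqOn σ₁ σ₂ (Icc 0 ℓ)) ∧
      ∀ p : M, (Continuous fun w : E => riemannianExpMap g p (show TangentSpace I p from w)) ∧
        ∀ q : M, ∃ v : TangentSpace I p,
          IsMinimizingUpTo g hg p v 1 ∧ riemannianExpMap g p v = q) :
    bishop1977_ordinary_dense.{u, v, w} := by
  intro E _ _ _ H _ I _ M _ _ _ _ _ g hg hc p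
  haveI : CompleteSpace E := FiniteDimensional.complete ℝ E
  haveI : g.HasLeviCivita := g.hasLeviCivita
  haveI : CovariantDerivative.ContMDiffCovariantDerivative g.leviCivita 1 :=
    ⟨g.isLocallyContMDiff_leviCivita_holds 1
      (by rw [show ((1 : ℕ∞) : ℕ∞ω) + 1 = 2 by norm_num]; exact WithTop.coe_le_coe.2 le_top)
      univ isOpen_univ⟩
  obtain ⟨hNB, hrest⟩ := hlocal I g hg hc
  obtain ⟨hexc, hHR⟩ := hrest p
  exact cutLocus_subset_closure_of_hopfRinow hg hc hNB hexc hHR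

end Fact

end Literature.Geometry.Riemannian
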